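import Mathlib
import Summits.NavierStokesRegularity.NavierStokesRegularity.Theorems.LerayQuarterDissipationFiniteDissipationLiouvilleVorticityAmplitudeSlack
import Summits.NavierStokesRegularity.NavierStokesRegularity.Theorems.LerayQuarterDissipationFiniteDissipationLiouvilleQuietVorticity
import Summits.NavierStokesRegularity.NavierStokesRegularity.Theorems.LerayQuarterDissipationFiniteDissipationLiouvilleCalmSliceForward
import HarnessLib

/-!
# Crux `FiniteDissipationLiouville` (stmt-NavierStokesRegularity-22144): the vorticity-amplitude
# threshold `√3/4` IS NOT ATTAINED on a singular member, and is exceeded by a definite amount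
# (threshold file 2/2)

Theorems file of route `LerayQuarterDissipation` (lead prover g15; `--supports` the crux; portrait
fact for the registered stub `stub_envelopeCriticalLiouville` of skeleton `Lines/birth.lean`;
sequel of `…VorticityAmplitude`). Navier–Stokes regularity is NOT proved by anything here; no summit
is.

`𝒟_{C,K}`: Type-I ancient mild fields `V` (KNSS gauge, `IsTypeIAncientMild C V`) with the
quarter-rate law `∫‖DV(t)‖² ≤ K/√(−t)`; `U = lerayOrbit V`, `Ω = lerayVorticity V = curl U`;
`Z_R = ∫φ_R²‖Ω‖²`, `Z_∞(s) = ∫‖Ω(s)‖²`, `D_R = ∫φ_R²|∇Ω|²_F` (squared radial cutoff `φ_R²`).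
`…VorticityAmplitude.eq_zero_of_vorticity_lt`: `(−t)‖curl V‖ ≤ C_ω < √3/4` everywhere ⇒ `V ≡ 0`.
This file treats the EQUALITY case `C_ω = √3/4` by the method of `…ThresholdOne` / `…ThresholdK`,
the slack being here the DISSIPATION itself (which the rung simply discarded):

* (file 1/2 `…VorticityAmplitudeSlack`: `exists_sqCutoffDissipation_lt` — for `‖Ω‖ ≤ √3/4` the localised
  dissipation `D_R = ∫φ_R²|∇Ω|²_F` is somewhere `< η`, every `R ≥ 1`, `η > 0`;
  `tendsto_sqCutoffDissipation_zero` — `D_R` at similarity time `0` is continuous along KNSS limits;)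
* **`not_singular_of_vorticity_le`** — **NO SINGULAR member of `𝒟_{C,K}` (any `C`, `K`) has
  `(−t)‖curl V(t,x)‖ ≤ √3/4` for all `t < 0`, `x`**: rescale the small-dissipation times to `t = −1`,
  pass to a KNSS limit `W ∈ 𝒟_{C,K}` (`Compactness.seqLimit`, `law_of_seqLimit`), SINGULAR by
  persistence (`persistent_singularity_seq`), whose slice `t = −1` has `D(curl W(−1)) ≡ 0`; a constant
  square-integrable vorticity on `ℝ³` vanishes, an irrotational slice of a member of `𝒟` vanishes
  (`QuietVorticity.slice_eq_zero_of_curl_eq_zero`), and a member with a zero slice is not singular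
  (`CalmSlice.not_singular_of_zero_slice`);
* **`exists_vorticity_gap`**, `vorticity_exceeds_gap_of_singular` — by compactness across members:
  **for all `C, K` there is `ε(C,K) > 0` such that no singular member of `𝒟_{C,K}` has
  `(−t)‖curl V(t,x)‖ ≤ √3/4 + ε` everywhere**; PORTRAIT: the scale-invariant vorticity amplitude of
  the hypothetical minimal counterexample EXCEEDS `√3/4 + ε(C,K)` somewhere.

HONEST FRAMING. `ε(C,K)` is ineffective (compactness); an explicit-threshold portrait clause of the
singular stratum, parallel to THRESHOLD ONE (`C > 1 + ε(K)`) and the dissipation threshold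
(`θ(K)⁴ > 64/27 + ε'(C)`); nothing is removed from the catalogued DSS wall (`TypeIDSSLiouville`,
NECESSARY for the crux); nothing here bears on Navier–Stokes regularity or blow-up.

References: Koch–Nadirashvili–Seregin–Šverák, Acta Math. 203 (2009) §4 (compactness of the class);
folklore energy method.
-/

noncomputable section

set_option linter.dupNamespace false

namespace Summit.NavierStokesRegularity.NavierStokesRegularity.Theorems.FiniteDissipationLiouville.VorticityAmplitude

open MeasureTheory Set Filter Topology Metric InnerProductSpace Function Real
open scoped RealInnerProductSpace ContDiff ENNReal Laplacian
open Literature.Analysis Literature.Analysis.FluidPDE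
open Summit.NavierStokesRegularity.NavierStokesRegularity.Theorems
open Summit.NavierStokesRegularity.NavierStokesRegularity.Theorems.GaussianGap
open Summit.NavierStokesRegularity.NavierStokesRegularity.Theorems.SimilarityEnstrophy
open Summit.NavierStokesRegularity.NavierStokesRegularity.Theorems.SmallDissipationGap
open Summit.NavierStokesRegularity.NavierStokesRegularity.Theorems.FiniteDissipationLiouville

variable {C : ℝ} {V : ℝ → (EuclideanSpace ℝ (Fin 3)) → (EuclideanSpace ℝ (Fin 3))}

/-! ### The threshold is not attained: no singular member has `(−t)‖ω‖ ≤ √3/4` -/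

section Threshold

/-- A constant square-integrable field on `ℝ³` vanishes. [folklore] -/
theorem eq_zero_of_const_of_integrable_sq {Ω : EuclideanSpace ℝ (Fin 3) → EuclideanSpace ℝ (Fin 3)}
    (hconst : ∀ x, Ω x = Ω 0) (hint : Integrable fun x => ‖Ω x‖ ^ 2) : ∀ x, Ω x = 0 := by
  by_contra h
  push Not at h
  obtain ⟨x, hx⟩ := h
  have hv : 0 < ‖Ω 0‖ ^ 2 := by
    rw [← hconst x]; exact pow_pos (norm_pos_iff.2 hx) 2
  have hint' : Integrable (fun _ : EuclideanSpace ℝ (Fin 3) => ‖Ω 0‖ ^ 2) volume :=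
    (integrable_congr (Eventually.of_forall fun y => by rw [hconst y])).1 hint
  have hfin : IsFiniteMeasure (volume : Measure (EuclideanSpace ℝ (Fin 3))) :=
    (integrable_const_iff_isFiniteMeasure hv.ne').1 hint'
  have htop : (volume : Measure (EuclideanSpace ℝ (Fin 3))) univ = ⊤ :=
    measure_univ_of_isAddLeftInvariant _
  exact absurd htop (measure_lt_top volume univ).ne

set_option maxHeartbeats 400000 in
/-- **THE VORTICITY-AMPLITUDE THRESHOLD IS NOT ATTAINED.** No SINGULAR member `V` of `𝒟_{C,K}` (any
`C`, any `K`) has `(−t)‖curl V(t,x)‖ ≤ √3/4` for all `t < 0` and all `x`. Proof: by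
`exists_sqCutoffDissipation_lt` there are similarity times `σ_n` with `D_{n+1}(σ_n) < 1/(n+1)`;
rescale them to `t = −1` (`v_n = nsRescale (e^{−σ_n/2}) V ∈ 𝒟_{C,K}`, singular, with
`curl v_n(−1) = Ω(σ_n)`); a KNSS limit `W ∈ 𝒟_{C,K}` of the `v_n` (`Compactness.seqLimit`,
`law_of_seqLimit`) is SINGULAR (`persistent_singularity_seq`) and, by
`tendsto_sqCutoffDissipation_zero`, has `∫χ|D(curl W(−1))|²_F = 0` on every cutoff, so `curl W(−1)` is
constant, hence zero (square-integrable), so the slice `W(−1)` vanishes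
(`QuietVorticity.slice_eq_zero_of_curl_eq_zero`) and `W` is not singular
(`CalmSlice.not_singular_of_zero_slice`) — contradiction. [cite: KochNadirashviliSereginSverak2009, §4 (arXiv:0709.3599 p. 8)] -/
theorem not_singular_of_vorticity_le (hV : IsTypeIAncientMild C V) {K : ℝ}
    (hK : ∀ t : ℝ, t < 0 → ∫⁻ x, ‖fderiv ℝ (V t) x‖ₑ ^ 2 ≤ ENNReal.ofReal (K / Real.sqrt (-t)))
    (hω : ∀ t : ℝ, t < 0 → ∀ x, (-t) * ‖curl (V t) x‖ ≤ Real.sqrt 3 / 4) :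
    ¬ (∀ r > 0, ∀ M : ℝ, ∃ t ∈ Set.Ioo (-(r ^ 2)) (0 : ℝ),
        ∃ x ∈ Metric.ball (0 : EuclideanSpace ℝ (Fin 3)) r, M < ‖V t x‖) := by
  intro hsing
  have hΩ : ∀ s y, ‖lerayVorticity V s y‖ ≤ Real.sqrt 3 / 4 := fun s y =>
    norm_lerayVorticity_le_of_vorticity_le hω s y
  have hC0 : (0 : ℝ) ≤ Real.sqrt 3 / 4 := by positivity
  -- ### times with small localised dissipation on growing cutoffs
  have hsn : ∀ n : ℕ, ∃ s : ℝ, ∫ y, smoothTransition (2 - ‖y‖ ^ 2 / ((n : ℝ) + 1) ^ 2) ^ 2 *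
      frobeniusNormSq (fderiv ℝ (lerayVorticity V s) y) < 1 / ((n : ℝ) + 1) := by
    intro n
    have hn1 : (1 : ℝ) ≤ (n : ℝ) + 1 := by
      have : (0 : ℝ) ≤ n := n.cast_nonneg
      linarith
    exact exists_sqCutoffDissipation_lt hV hK hC0 le_rfl hΩ hn1 (by positivity)
  choose sn hsn using hsn
  -- ### the rescaled members
  set v : ℕ → ℝ → EuclideanSpace ℝ (Fin 3) → EuclideanSpace ℝ (Fin 3) := fun n =>
    nsRescale (Real.exp (-(sn n) / 2)) V with hvdef
  have hμ : ∀ n, 0 < Real.exp (-(sn n) / 2) := fun n => Real.exp_pos _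
  have hv : ∀ n, IsTypeIAncientMild C (v n) := fun n => hV.nsRescale (hμ n)
  have hvlaw : ∀ n, ∀ s : ℝ, s < 0 →
      ∫⁻ x, ‖fderiv ℝ (v n s) x‖ₑ ^ 2 ≤ ENNReal.ofReal (K / Real.sqrt (-s)) := fun n =>
    RecurrentReductionD.dissipationLaw_nsRescale hK (hμ n)
  have hvsing : ∀ n, ∀ r > 0, ∀ M : ℝ, ∃ t ∈ Ioo (-(r ^ 2)) (0 : ℝ),
      ∃ x ∈ ball (0 : EuclideanSpace ℝ (Fin 3)) r, M < ‖v n t x‖ := fun n =>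
    RecurrentReductionD.singularAtOrigin_nsRescale hsing (hμ n)
  -- the vorticity of `v n` at `t = -1` is the similarity vorticity of `V` at time `sn n`
  have hΩeq : ∀ n, curl (v n (-1)) = lerayVorticity V (sn n) := by
    intro n
    have hs : (0 : ℝ) - 2 * Real.log (Real.exp (-(sn n) / 2)) = sn n := by rw [Real.log_exp]; ring
    rw [lerayVorticity_apply, ← ThresholdOne.lerayOrbit_zero (v n), hvdef, lerayOrbit_nsRescale (hμ n), hs]
  have hDn : ∀ n : ℕ, ∫ y, smoothTransition (2 - ‖y‖ ^ 2 / ((n : ℝ) + 1) ^ 2) ^ 2 *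
      frobeniusNormSq (fderiv ℝ (curl (v n (-1))) y) < 1 / ((n : ℝ) + 1) := fun n => by
    rw [hΩeq n]; exact hsn n
  -- ### compactness across members
  obtain ⟨ψ, hψ, W, hW, hunif, hpt, hgrad⟩ := Compactness.seqLimit hv
  have hψt : Tendsto ψ atTop atTop := hψ.tendsto_atTop
  have hWlaw : ∀ s : ℝ, s < 0 →
      ∫⁻ x, ‖fderiv ℝ (W s) x‖ₑ ^ 2 ≤ ENNReal.ofReal (K / Real.sqrt (-s)) :=
    Compactness.law_of_seqLimit (Kk := fun _ => K) (Kinf := K) hψt hvlaw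
      (fun ε hε => Eventually.of_forall fun k => by linarith) hgrad
  have hWsing := Compactness.persistent_singularity_seq (w := fun j => v (ψ j))
    (fun j => hv _) (fun j => hvlaw _) (fun j => hvsing _) hW hunif
  -- ### the vorticity gradient of the limit slice vanishes
  have hW1 : ContDiff ℝ 1 (curl (W (-1))) :=
    contDiff_curl (((hW.contDiff_slice (by norm_num)).of_le (by norm_cast)) : ContDiff ℝ 2 (W (-1)))
  have hcG : Continuous fun z => frobeniusNormSq (fderiv ℝ (curl (W (-1))) z) :=
    continuous_frobeniusNormSq_fderiv hW1 (by simp)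
  have hDW : ∀ y, fderiv ℝ (curl (W (-1))) y = 0 := by
    intro y
    set ρ : ℝ := max 1 ‖y‖ with hρdef
    have hρ : 0 < ρ := lt_of_lt_of_le one_pos (le_max_left _ _)
    set χ : EuclideanSpace ℝ (Fin 3) → ℝ := fun z => smoothTransition (2 - ‖z‖ ^ 2 / ρ ^ 2) ^ 2 with hχdef
    have hχ0 : ∀ z, 0 ≤ χ z := fun z => sqCutoff_nonneg ρ z
    have hχ1 : ∀ z, χ z ≤ 1 := fun z => sqCutoff_le_one ρ z
    have hχz : ∀ z ∉ closedBall (0 : EuclideanSpace ℝ (Fin 3)) (2 * ρ), χ z = 0 := fun z hz =>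
      sqCutoff_eq_zero_of_notMem hρ hz
    have hχc : Continuous χ := (contDiff_sqCutoff (n := 1) ρ).continuous
    have hχcs : HasCompactSupport χ := hasCompactSupport_sqCutoff hρ
    -- the localised dissipation of the limit is the limit of the localised dissipations
    have hkey : Tendsto (fun j => ∫ z, χ z * frobeniusNormSq (fderiv ℝ (curl (v (ψ j) (-1))) z)) atTop
        (𝓝 (∫ z, χ z * frobeniusNormSq (fderiv ℝ (curl (W (-1))) z))) :=
      tendsto_sqCutoffDissipation_zero (fun j => hv (ψ j)) hW hunif hρ
    -- and it is eventually `≤ 1/(ψ j + 1) → 0`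
    have hidx : Tendsto (fun j => ((ψ j : ℕ) : ℝ) + 1) atTop atTop :=
      tendsto_atTop_add_const_right _ 1 (tendsto_natCast_atTop_atTop.comp hψt)
    have hev : ∀ᶠ j in atTop, 2 * ρ ≤ ((ψ j : ℕ) : ℝ) + 1 := hidx.eventually_ge_atTop (2 * ρ)
    have hle : ∀ᶠ j in atTop, ∫ z, χ z * frobeniusNormSq (fderiv ℝ (curl (v (ψ j) (-1))) z) ≤
        1 / (((ψ j : ℕ) : ℝ) + 1) := by
      filter_upwards [hev] with j hj
      set n := ψ j with hn
      have hR : (0 : ℝ) < (n : ℝ) + 1 := by positivity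
      have hcn : Continuous fun z => frobeniusNormSq (fderiv ℝ (curl (v n (-1))) z) := by
        have h2 : ContDiff ℝ 2 (v n (-1)) := ((hv n).contDiff_slice (by norm_num)).of_le (by norm_cast)
        exact continuous_frobeniusNormSq_fderiv (contDiff_curl h2 (n := 1)) (by simp)
      refine le_trans (integral_mono_of_nonneg (Eventually.of_forall fun z =>
        mul_nonneg (hχ0 z) (frobeniusNormSq_nonneg _)) ?_ (Eventually.of_forall fun z => ?_)) (hDn n).le
      · exact ((contDiff_sqCutoff (n := 1) ((n : ℝ) + 1)).continuous.mul hcn).integrable_of_hasCompactSupport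
          (hasCompactSupport_sqCutoff hR).mul_right
      · show χ z * frobeniusNormSq (fderiv ℝ (curl (v n (-1))) z) ≤
          smoothTransition (2 - ‖z‖ ^ 2 / ((n : ℝ) + 1) ^ 2) ^ 2 * frobeniusNormSq (fderiv ℝ (curl (v n (-1))) z)
        refine mul_le_mul_of_nonneg_right ?_ (frobeniusNormSq_nonneg _)
        by_cases hz : ‖z‖ ≤ (n : ℝ) + 1
        · rw [sqCutoff_eq_one hR hz]; exact hχ1 z
        · have hz' : z ∉ closedBall (0 : EuclideanSpace ℝ (Fin 3)) (2 * ρ) := by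
            rw [mem_closedBall, dist_zero_right]
            push Not at hz ⊢
            linarith
          rw [hχz z hz']; exact sqCutoff_nonneg _ z
    have hlim0 : Tendsto (fun j => 1 / (((ψ j : ℕ) : ℝ) + 1)) atTop (𝓝 0) :=
      tendsto_const_nhds.div_atTop hidx
    have hge : ∀ j, 0 ≤ ∫ z, χ z * frobeniusNormSq (fderiv ℝ (curl (v (ψ j) (-1))) z) := fun j =>
      integral_nonneg fun z => mul_nonneg (hχ0 z) (frobeniusNormSq_nonneg _)
    have hI1 : ∫ z, χ z * frobeniusNormSq (fderiv ℝ (curl (W (-1))) z) ≤ 0 :=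
      le_of_tendsto_of_tendsto hkey hlim0 hle
    have hI2 : 0 ≤ ∫ z, χ z * frobeniusNormSq (fderiv ℝ (curl (W (-1))) z) := ge_of_tendsto' hkey hge
    have hI0 : ∫ z, χ z * frobeniusNormSq (fderiv ℝ (curl (W (-1))) z) = 0 := le_antisymm hI1 hI2
    have hint : Integrable fun z => χ z * frobeniusNormSq (fderiv ℝ (curl (W (-1))) z) :=
      (hχc.mul hcG).integrable_of_hasCompactSupport hχcs.mul_right
    have hae : (fun z => χ z * frobeniusNormSq (fderiv ℝ (curl (W (-1))) z)) =ᵐ[volume] 0 :=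
      (integral_eq_zero_iff_of_nonneg (fun z => mul_nonneg (hχ0 z) (frobeniusNormSq_nonneg _)) hint).1 hI0
    have hall : (fun z => χ z * frobeniusNormSq (fderiv ℝ (curl (W (-1))) z)) = 0 :=
      (hχc.mul hcG).ae_eq_iff_eq volume continuous_const |>.1 hae
    have hy : χ y * frobeniusNormSq (fderiv ℝ (curl (W (-1))) y) = 0 := congrFun hall y
    have hχy : χ y = 1 := sqCutoff_eq_one hρ (le_max_right _ _)
    rw [hχy, one_mul] at hy
    have h2 := sq_opNorm_le_frobeniusNormSq (fderiv ℝ (curl (W (-1))) y)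
    rw [hy] at h2
    have h3 : ‖fderiv ℝ (curl (W (-1))) y‖ = 0 := by nlinarith [norm_nonneg (fderiv ℝ (curl (W (-1))) y)]
    exact norm_eq_zero.1 h3
  -- ### a constant square-integrable vorticity vanishes; so does the slice; contradiction
  have hconst : ∀ x, curl (W (-1)) x = curl (W (-1)) 0 := fun x =>
    is_const_of_fderiv_eq_zero (hW1.differentiable one_ne_zero) hDW x 0
  have hint : Integrable fun x => ‖curl (W (-1)) x‖ ^ 2 := by
    have h := (integrable_sq_norm_lerayVorticity hW hWlaw 0).1
    rw [lerayVorticity_apply, ThresholdOne.lerayOrbit_zero] at h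
    exact h
  have hcurl0 : ∀ x, curl (W (-1)) x = 0 := eq_zero_of_const_of_integrable_sq hconst hint
  have hslice : ∀ x, W (-1) x = 0 :=
    QuietVorticity.slice_eq_zero_of_curl_eq_zero hW hWlaw (by norm_num) hcurl0
  exact CalmSlice.not_singular_of_zero_slice hW (by norm_num) hslice hWsing

end Threshold

/-! ### The threshold is exceeded by a definite amount: the collar `√3/4 + ε(C,K)` -/

section Collar

/-- **THE VORTICITY-AMPLITUDE COLLAR.** For all `C, K` there is `ε > 0` such that no SINGULAR member
of `𝒟_{C,K}` has `(−t)‖curl V(t,x)‖ ≤ √3/4 + ε` for all `t < 0`, `x`. By compactness across members: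
a sequence of singular members with amplitudes `≤ √3/4 + 1/(n+1)` has a KNSS limit in `𝒟_{C,K}`
(`Compactness.seqLimit`, `law_of_seqLimit`), SINGULAR (`persistent_singularity_seq`), whose vorticity —
the pointwise limit of the vorticities (`curl = curlCLM ∘ D`, gradients converge at every `t < 0`)
— has amplitude `≤ √3/4`: excluded by `not_singular_of_vorticity_le`. HONEST FRAMING: `ε(C,K)` is
ineffective. [cite: KochNadirashviliSereginSverak2009, §4 (arXiv:0709.3599 p. 8)] -/
theorem exists_vorticity_gap (C K : ℝ) : ∃ ε : ℝ, 0 < ε ∧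
    ∀ (V : ℝ → EuclideanSpace ℝ (Fin 3) → EuclideanSpace ℝ (Fin 3)), IsTypeIAncientMild C V →
      (∀ t : ℝ, t < 0 → ∫⁻ x, ‖fderiv ℝ (V t) x‖ₑ ^ 2 ≤ ENNReal.ofReal (K / Real.sqrt (-t))) →
      (∀ t : ℝ, t < 0 → ∀ x, (-t) * ‖curl (V t) x‖ ≤ Real.sqrt 3 / 4 + ε) →
      ¬ (∀ r > 0, ∀ M : ℝ, ∃ t ∈ Set.Ioo (-(r ^ 2)) (0 : ℝ),
          ∃ x ∈ Metric.ball (0 : EuclideanSpace ℝ (Fin 3)) r, M < ‖V t x‖) := by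
  by_contra h
  push Not at h
  have hn : ∀ n : ℕ, ∃ V : ℝ → EuclideanSpace ℝ (Fin 3) → EuclideanSpace ℝ (Fin 3),
      IsTypeIAncientMild C V ∧
      (∀ t : ℝ, t < 0 → ∫⁻ x, ‖fderiv ℝ (V t) x‖ₑ ^ 2 ≤ ENNReal.ofReal (K / Real.sqrt (-t))) ∧
      (∀ t : ℝ, t < 0 → ∀ x, (-t) * ‖curl (V t) x‖ ≤ Real.sqrt 3 / 4 + 1 / ((n : ℝ) + 1)) ∧
      (∀ r > 0, ∀ M : ℝ, ∃ t ∈ Set.Ioo (-(r ^ 2)) (0 : ℝ),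
          ∃ x ∈ Metric.ball (0 : EuclideanSpace ℝ (Fin 3)) r, M < ‖V t x‖) := fun n =>
    h (1 / ((n : ℝ) + 1)) (by positivity)
  choose v hv hvlaw hvω hvsing using hn
  obtain ⟨ψ, hψ, W, hW, hunif, hpt, hgrad⟩ := Compactness.seqLimit hv
  have hψt : Tendsto ψ atTop atTop := hψ.tendsto_atTop
  have hWlaw : ∀ s : ℝ, s < 0 →
      ∫⁻ x, ‖fderiv ℝ (W s) x‖ₑ ^ 2 ≤ ENNReal.ofReal (K / Real.sqrt (-s)) :=
    Compactness.law_of_seqLimit (Kk := fun _ => K) (Kinf := K) hψt hvlaw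
      (fun ε hε => Eventually.of_forall fun k => by linarith) hgrad
  have hWsing := Compactness.persistent_singularity_seq (w := fun j => v (ψ j))
    (fun j => hv _) (fun j => hvlaw _) (fun j => hvsing _) hW hunif
  -- the vorticity amplitude of the limit is `≤ √3/4`
  have hWω : ∀ t : ℝ, t < 0 → ∀ x, (-t) * ‖curl (W t) x‖ ≤ Real.sqrt 3 / 4 := by
    intro t ht x
    have h1 : Tendsto (fun j => (-t) * ‖curl (v (ψ j) t) x‖) atTop (𝓝 ((-t) * ‖curl (W t) x‖)) := by
      have hc : Tendsto (fun j => curl (v (ψ j) t) x) atTop (𝓝 (curl (W t) x)) := by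
        simp only [curl_eq_curlCLM]
        exact (curlCLM.continuous.tendsto _).comp (hgrad t ht x)
      exact tendsto_const_nhds.mul hc.norm
    have hidx : Tendsto (fun j => ((ψ j : ℕ) : ℝ) + 1) atTop atTop :=
      tendsto_atTop_add_const_right _ 1 (tendsto_natCast_atTop_atTop.comp hψt)
    have h2 : Tendsto (fun j => Real.sqrt 3 / 4 + 1 / (((ψ j : ℕ) : ℝ) + 1)) atTop
        (𝓝 (Real.sqrt 3 / 4 + 0)) :=
      tendsto_const_nhds.add (tendsto_const_nhds.div_atTop hidx)
    rw [add_zero] at h2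
    exact le_of_tendsto_of_tendsto' h1 h2 fun j => hvω (ψ j) t ht x
  exact not_singular_of_vorticity_le hW hWlaw hWω hWsing

/-- **PORTRAIT: the vorticity amplitude of a finite-dissipation Type-I singularity exceeds
`√3/4 + ε(C,K)`.** For all `C, K` there is `ε > 0` such that every SINGULAR member of `𝒟_{C,K}` has
an instant `t < 0` and a point `x` with `√3/4 + ε < (−t)‖curl V(t,x)‖`. No DSS scenario of the
catalogued wall is removed. [folklore] -/
theorem vorticity_exceeds_gap_of_singular (C K : ℝ) : ∃ ε : ℝ, 0 < ε ∧
    ∀ (V : ℝ → EuclideanSpace ℝ (Fin 3) → EuclideanSpace ℝ (Fin 3)), IsTypeIAncientMild C V →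
      (∀ t : ℝ, t < 0 → ∫⁻ x, ‖fderiv ℝ (V t) x‖ₑ ^ 2 ≤ ENNReal.ofReal (K / Real.sqrt (-t))) →
      (∀ r > 0, ∀ M : ℝ, ∃ t ∈ Set.Ioo (-(r ^ 2)) (0 : ℝ),
          ∃ x ∈ Metric.ball (0 : EuclideanSpace ℝ (Fin 3)) r, M < ‖V t x‖) →
      ∃ t : ℝ, t < 0 ∧ ∃ x, Real.sqrt 3 / 4 + ε < (-t) * ‖curl (V t) x‖ := by
  obtain ⟨ε, hε, h⟩ := exists_vorticity_gap C K
  refine ⟨ε, hε, fun V hV hK hsing => ?_⟩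
  by_contra hc
  push Not at hc
  exact h V hV hK (fun t ht x => hc t ht x) hsing

/-- **The crux restricted to the vorticity-amplitude region, in the crux's own quantifier shape.**
For all `C, K` there is `ε > 0` such that `FiniteDissipationLiouville` holds for every member of
`𝒟_{C,K}` whose scale-invariant vorticity amplitude is at most `√3/4 + ε`. (Bookkeeping.) -/
theorem finiteDissipationLiouville_below_vorticity_gap (C K : ℝ) : ∃ ε : ℝ, 0 < ε ∧
    ∀ (ū : ℝ → EuclideanSpace ℝ (Fin 3) → EuclideanSpace ℝ (Fin 3)), IsTypeIAncientMild C ū →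
      (∀ s : ℝ, s < 0 → ∫⁻ x, ‖fderiv ℝ (ū s) x‖ₑ ^ 2 ≤ ENNReal.ofReal (K / Real.sqrt (-s))) →
      (∀ t : ℝ, t < 0 → ∀ x, (-t) * ‖curl (ū t) x‖ ≤ Real.sqrt 3 / 4 + ε) →
      ¬ (∀ r > 0, ∀ M : ℝ, ∃ t ∈ Set.Ioo (-(r ^ 2)) (0 : ℝ),
          ∃ x ∈ Metric.ball (0 : EuclideanSpace ℝ (Fin 3)) r, M < ‖ū t x‖) :=
  exists_vorticity_gap C K

end Collar

end Summit.NavierStokesRegularity.NavierStokesRegularity.Theorems.FiniteDissipationLiouville.VorticityAmplitude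

end
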